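import Summits.NavierStokesRegularity.NavierStokesRegularity.Theses.TerminalTrace
import Summits.NavierStokesRegularity.NavierStokesRegularity.Theorems.PlaneEnergyCeilingPlanarEnergyAPrioriFinalTime
import HarnessLib

/-!
# Crux `PlanarEnergyAPriori` (stmt-NavierStokesRegularity-16855), route PlaneEnergyCeiling:
  the cross-route edge `PlanarEnergyAPriori ⇒ TerminalTrace.NoTraceConcentration`

Helper file for the crux item stmt-NavierStokesRegularity-16855
(`Summit.NavierStokesRegularity.NavierStokesRegularity.Theses.PlaneEnergyCeiling.PlanarEnergyAPriori`).

**Main result** (`noTraceConcentration_of_planarEnergyAPriori`, registered anchor): the planar-energy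
ceiling implies crux (B) of route TerminalTrace (item stmt-NavierStokesRegularity-18381,
`Theses.TerminalTrace.NoTraceConcentration`: the final value `u T` of a frame solution has no scaled
energy concentration, `r⁻¹ ∫_{B(x₀,r)} |u(T)|² → 0` at EVERY point):

  `PlanarEnergyAPriori → NoTraceConcentration`.

Proof: given the crux, the Hardy ceiling persists to the weak-`L²` final slice,
`∫ |u(T,y)|²/|y − x₀| dy ≤ K` (`PlanarEnergyAPriori.hardyCeiling_final`,
`Theorems/PlaneEnergyCeilingPlanarEnergyAPrioriFinalTime.lean`); on the ball `B(x₀, r)` the weight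
dominates `r⁻¹`, so `r⁻¹ ∫_{B(x₀,r)} |u(T)|² ≤ ∫_{B(x₀,r)} |u(T)|²/|y − x₀|`, and the right side tends
to `0` with `r` by absolute continuity of the (finite) Hardy integral (`tendsto_setLIntegral_zero`,
`|B(x₀,r)| = r³|B₁| → 0`). Together with `hardyEnergyBound_of_planarEnergyAPriori`
(`…HardyBridge.lean`) this places crux 16855 formally ABOVE the two a-priori cruxes 7979
(HardyPointSink C2) and 18381 (TerminalTrace B): a refutation of either refutes the planar ceiling.

* `tendsto_scaledEnergy_zero_of_hardy` — the measure-theoretic step for one slice `w ∈ L²` with a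
  finite Hardy integral at `x₀`;
* `noTraceConcentration_of_planarEnergyAPriori` — the edge.
-/

noncomputable section

-- Problem = summit for this single-conjunct summit: the duplicate namespace component is deliberate.
set_option linter.dupNamespace false

namespace Summit.NavierStokesRegularity.NavierStokesRegularity.Theorems.PlanarEnergyAPriori

open MeasureTheory Set Filter Topology Metric
open scoped ENNReal NNReal
open Literature.Analysis.FluidPDE

/-- **A finite Hardy integral at `x₀` forbids scaled-energy concentration at `x₀`.** If
`w : ℝ³ → ℝ³` is a.e.-strongly measurable and `∫ |w(y)|²/|y − x₀| dy < ∞`, then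
`r⁻¹ ∫_{B(x₀,r)} |w|² → 0` as `r → 0⁺` (the weight dominates `r⁻¹` on the ball; absolute continuity
of the Lebesgue integral on balls of vanishing volume). -/
theorem tendsto_scaledEnergy_zero_of_hardy {w : EuclideanSpace ℝ (Fin 3) → EuclideanSpace ℝ (Fin 3)}
    (hw : AEStronglyMeasurable w volume) (x₀ : EuclideanSpace ℝ (Fin 3))
    (hK : ∫⁻ y, ‖w y‖ₑ ^ 2 / ‖y - x₀‖ₑ ≠ ⊤) :
    Tendsto (fun r : ℝ => r⁻¹ * ∫ x in ball x₀ r, ‖w x‖ ^ 2) (𝓝[>] 0) (𝓝 0) := by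
  set f : EuclideanSpace ℝ (Fin 3) → ℝ≥0∞ := fun y => ‖w y‖ₑ ^ 2 / ‖y - x₀‖ₑ with hf
  -- ### the upper function `g r = (∫_{B(x₀,r)} f).toReal` tends to `0`
  have hvol : Tendsto ((volume : Measure (EuclideanSpace ℝ (Fin 3))) ∘ fun r : ℝ => ball x₀ r)
      (𝓝[>] 0) (𝓝 0) := by
    have hform : ∀ r ∈ Ioi (0 : ℝ), ((volume : Measure (EuclideanSpace ℝ (Fin 3))) ∘
        fun r : ℝ => ball x₀ r) r = ENNReal.ofReal (r ^ 3) * volume (ball (0 : EuclideanSpace ℝ (Fin 3)) 1) := by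
      intro r hr
      simp only [Function.comp_apply]
      rw [Measure.addHaar_ball volume x₀ (le_of_lt hr), finrank_euclideanSpace_fin,
        ENNReal.ofReal_pow (le_of_lt hr)]
    have hlim : Tendsto (fun r : ℝ => ENNReal.ofReal (r ^ 3) *
        volume (ball (0 : EuclideanSpace ℝ (Fin 3)) 1)) (𝓝[>] 0) (𝓝 0) := by
      have h1 : Tendsto (fun r : ℝ => r ^ 3) (𝓝[>] (0 : ℝ)) (𝓝 0) := by
        have := ((continuous_pow 3).tendsto (0 : ℝ)).mono_left (nhdsWithin_le_nhds (s := Ioi (0:ℝ)))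
        simpa using this
      have h2 : Tendsto (fun r : ℝ => ENNReal.ofReal (r ^ 3)) (𝓝[>] (0 : ℝ)) (𝓝 0) := by
        have := (ENNReal.continuous_ofReal.tendsto 0).comp h1
        rwa [ENNReal.ofReal_zero] at this
      have h3 := ENNReal.Tendsto.mul_const h2
        (Or.inr (measure_ball_lt_top (μ := (volume : Measure (EuclideanSpace ℝ (Fin 3))))
          (x := (0 : EuclideanSpace ℝ (Fin 3))) (r := (1 : ℝ))).ne)
      simpa using h3
    exact (tendsto_congr' (eventually_nhdsWithin_of_forall hform)).2 hlim
  have hg : Tendsto (fun r : ℝ => (∫⁻ y in ball x₀ r, f y).toReal) (𝓝[>] 0) (𝓝 0) := by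
    have h1 : Tendsto (fun r : ℝ => ∫⁻ y in ball x₀ r, f y) (𝓝[>] 0) (𝓝 0) :=
      tendsto_setLIntegral_zero hK hvol
    have h2 := (ENNReal.tendsto_toReal ENNReal.zero_ne_top).comp h1
    rwa [ENNReal.toReal_zero] at h2
  -- ### squeeze `0 ≤ r⁻¹ ∫_{B_r} |w|² ≤ g r`
  refine tendsto_of_tendsto_of_tendsto_of_le_of_le' tendsto_const_nhds hg ?_ ?_
  · filter_upwards [self_mem_nhdsWithin] with r hr
    exact mul_nonneg (inv_nonneg.2 (le_of_lt hr)) (integral_nonneg fun x => sq_nonneg _)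
  · filter_upwards [self_mem_nhdsWithin] with r hr
    have hr0 : (0 : ℝ) < r := hr
    -- the real integral as a lower integral
    rw [setIntegral_norm_sq_eq_toReal hw (ball x₀ r)]
    have hfin : ∫⁻ y in ball x₀ r, f y ≠ ⊤ := ne_top_of_le_ne_top hK (setLIntegral_le_lintegral _ _)
    -- `r⁻¹ ∫_{B_r} ‖w‖ₑ² ≤ ∫_{B_r} f` in `ℝ≥0∞`
    have hkey : (ENNReal.ofReal r)⁻¹ * ∫⁻ y in ball x₀ r, ‖w y‖ₑ ^ 2 ≤ ∫⁻ y in ball x₀ r, f y := by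
      rw [← lintegral_const_mul' _ _ (ENNReal.inv_ne_top.2 (ENNReal.ofReal_pos.2 hr0).ne')]
      refine setLIntegral_mono' measurableSet_ball fun y hy => ?_
      show (ENNReal.ofReal r)⁻¹ * ‖w y‖ₑ ^ 2 ≤ ‖w y‖ₑ ^ 2 / ‖y - x₀‖ₑ
      rw [ENNReal.div_eq_inv_mul]
      refine mul_le_mul' (ENNReal.inv_le_inv.2 ?_) le_rfl
      rw [← ofReal_norm, ← dist_eq_norm]
      exact ENNReal.ofReal_le_ofReal (le_of_lt (mem_ball.1 hy))
    have h1 : r⁻¹ * (∫⁻ y in ball x₀ r, ‖w y‖ₑ ^ 2).toReal =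
        ((ENNReal.ofReal r)⁻¹ * ∫⁻ y in ball x₀ r, ‖w y‖ₑ ^ 2).toReal := by
      rw [ENNReal.toReal_mul, ENNReal.toReal_inv, ENNReal.toReal_ofReal hr0.le]
    rw [h1]
    exact ENNReal.toReal_mono hfin hkey

/-- **Registered anchor `noTraceConcentration_of_planarEnergyAPriori`: the planar-energy ceiling crux
implies crux (B) `NoTraceConcentration` of route TerminalTrace.** Given the crux, the Hardy ceiling
persists to the final slice `u T` (`PlanarEnergyAPriori.hardyCeiling_final`), and a finite Hardy
integral at `x₀` forbids scaled-energy concentration there (`tendsto_scaledEnergy_zero_of_hardy`). -/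
theorem noTraceConcentration_of_planarEnergyAPriori :
    Summit.NavierStokesRegularity.NavierStokesRegularity.Theses.PlaneEnergyCeiling.PlanarEnergyAPriori →
    Summit.NavierStokesRegularity.NavierStokesRegularity.Theses.TerminalTrace.NoTraceConcentration := by
  intro hP ν T hν hT u p hcl hLH hdec x₀
  obtain ⟨K, -, hK⟩ := PlanarEnergyAPriori.hardyCeiling_final hP hν hT hcl hLH hdec
  have hfin : ∫⁻ y, ‖u T y‖ₑ ^ 2 / ‖y - x₀‖ₑ ≠ ⊤ :=
    ne_top_of_le_ne_top ENNReal.ofReal_ne_top (hK x₀)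
  exact tendsto_scaledEnergy_zero_of_hardy (hLH.memLp T ⟨hT.le, le_rfl⟩).1 x₀ hfin

end Summit.NavierStokesRegularity.NavierStokesRegularity.Theorems.PlanarEnergyAPriori

end
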